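import Mathlib
import Summits.Ventures.HodgeRepro2.T5LocalNormCharacter
import Summits.Ventures.HodgeRepro2.T5PrincipalUnitsDivisible
import Summits.Ventures.HodgeRepro2.T5AdicCompletionResidueField

/-!
# Characters of `Kvˣ` of order prime to the residue characteristic are continuous

`Kv = v.adicCompletion K` at a finite place `v`, `n` a natural number that is a UNIT of `O_Kv`
(`p ∤ n`, `p` the residue characteristic).

* `exists_pow_eq_of_val_sub_one_lt_one`: a unit `u ∈ Kvˣ` with `v (u − 1) < 1` is an `n`-th power
  in `Kvˣ` (`T5PrincipalUnitsDivisible`: the principal units are `n`-divisible when `n ∈ O_Kvˣ`);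
* `isOpen_of_forall_pow_mem`: a subgroup containing every `n`-th power contains the principal units,
  hence is OPEN (`T5LocalNormCharacter.isOpen_setOf_val_sub_one_lt_one`);
* **`continuous_of_forall_pow_eq_one (χ : Kvˣ →* M) (hχ : ∀ x, χ x ^ n = 1) : Continuous χ`** for any
  topological monoid `M`: every character of `Kvˣ` of order dividing `n`, `p ∤ n`, is continuous (the
  TAME automatic continuity; the order-`2` case at EVERY `p` is `T5QuadraticCharactersContinuous`).

Declaration per README §8(d): «uses an L-value-free non-vanishing device: NO».
-/

namespace Summit.Ventures.HodgeRepro2.T5TameCharactersContinuous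

open IsDedekindDomain HeightOneSpectrum IsLocalRing WithZero

variable {K : Type*} [Field K] [NumberField K] (v : HeightOneSpectrum (NumberField.RingOfIntegers K))
  {n : ℕ} (hn : IsUnit ((n : ℕ) : adicCompletionIntegers K v))

include hn in
/-- A principal unit of `Kvˣ` is an `n`-th power in `Kvˣ` when `n ∈ O_Kvˣ`. -/
theorem exists_pow_eq_of_val_sub_one_lt_one (u : (adicCompletion K v)ˣ)
    (hu : Valued.v ((u : adicCompletion K v) - 1) < 1) :
    ∃ y : (adicCompletion K v)ˣ, y ^ n = u := by
  have huO : (u : adicCompletion K v) ∈ adicCompletionIntegers K v := by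
    rw [mem_adicCompletionIntegers]
    have e : (u : adicCompletion K v) = ((u : adicCompletion K v) - 1) + 1 := (sub_add_cancel _ _).symm
    rw [e]
    exact (Valuation.map_add _ _ _).trans (max_le hu.le (by rw [map_one]))
  have hm : (⟨(u : adicCompletion K v), huO⟩ : adicCompletionIntegers K v) - 1 ∈
      maximalIdeal (adicCompletionIntegers K v) := by
    rw [T5AdicCompletionResidueField.mem_maximalIdeal_iff]
    simpa using hu
  obtain ⟨w, -, hw⟩ := T5PrincipalUnitsDivisible.exists_pow_eq_of_principal v hn hm
  have hy : ((w : adicCompletionIntegers K v) : adicCompletion K v) ^ n = (u : adicCompletion K v) := by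
    have h : ((w ^ n : adicCompletionIntegers K v) : adicCompletion K v) = (u : adicCompletion K v) :=
      congrArg Subtype.val hw
    rw [← h]
    push_cast
    ring
  have hn0 : n ≠ 0 := by
    rintro rfl
    simp at hn
  have hy0 : ((w : adicCompletionIntegers K v) : adicCompletion K v) ≠ 0 := by
    intro h0
    rw [h0, zero_pow hn0] at hy
    exact u.ne_zero hy.symm
  exact ⟨Units.mk0 _ hy0, Units.ext (by rw [Units.val_pow_eq_pow_val, Units.val_mk0, hy])⟩

include hn in
/-- A subgroup of `Kvˣ` containing every `n`-th power (`n ∈ O_Kvˣ`) is open. -/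
theorem isOpen_of_forall_pow_mem (H : Subgroup (adicCompletion K v)ˣ)
    (hH : ∀ x : (adicCompletion K v)ˣ, x ^ n ∈ H) : IsOpen (H : Set (adicCompletion K v)ˣ) := by
  apply Subgroup.isOpen_of_mem_nhds (g := 1)
  refine Filter.mem_of_superset ((T5LocalNormCharacter.isOpen_setOf_val_sub_one_lt_one v).mem_nhds
    (by simp)) ?_
  intro u hu
  obtain ⟨y, rfl⟩ := exists_pow_eq_of_val_sub_one_lt_one v hn u hu
  exact hH y

include hn in
/-- TAME AUTOMATIC CONTINUITY: a character of `Kvˣ` killed by `n ∈ O_Kvˣ` is continuous. -/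
theorem continuous_of_forall_pow_eq_one {M : Type*} [CommMonoid M] [TopologicalSpace M]
    [ContinuousMul M] (χ : (adicCompletion K v)ˣ →* M) (hχ : ∀ x, χ x ^ n = 1) : Continuous χ :=
  T5ProfiniteCharacterExtension.continuous_of_eq_one_on_open_subgroup χ χ.ker
    (isOpen_of_forall_pow_mem v hn χ.ker (fun x => by
      rw [MonoidHom.mem_ker, map_pow]; exact hχ x))
    (fun _ hy => hy)

end Summit.Ventures.HodgeRepro2.T5TameCharactersContinuous
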